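import Mathlib
import Literature.Geometry.Symplectic.StandardEnd
import Literature.Geometry.Symplectic.GromovR4RelEnd
import Literature.Geometry.Symplectic.OrigamiForm
import Summits.SmoothPoincare4.SmoothPoincare4.Theses.SymplecticOrigami
import Summits.SmoothPoincare4.SmoothPoincare4.Theorems.OrigamiFoldExistence.Negative.ZeroSlack

/-!
# Sketch — crux ideas of ideator 3 (round 1) for crux `OrigamiFoldExistence`
(item stmt-SmoothPoincare4-7844, route SymplecticOrigami)

First lemmas (signatures over existing declarations; nothing here is a proof of the crux):

* card `euclidean-fold-germ`:
  `HasInsideOutShell`, `HasMatchedSphere` (the transfer C⁺: full pointwise matching of the form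
  along ONE sphere around the puncture with the standard form along an embedded Euclidean sphere),
  `ShellRecognition`, `MatchedSphereRecognition`, and the composition
  `origamiFoldExistence_of_matchedSphere` concluding the crux BY NAME (pure logic, proved).
* card `stable-fold-ladder`:
  `IsStableFold` (a folded form together with a stabilising 1-form on the fold, in the
  vector-field form of Cieliebak–Volkov), `StableSphereFoldExistence`, `StableSphereFoldRigidity`,
  `origamiFoldExistence_of_stableFold` (proved composition).
* card `orbifold-unfolding-cork-seams`:
  `IsSeifertOrigamiForm` (origami with the freeness of the null circle action relaxed to finite
  stabilisers = Seifert null fibration), `SeifertFoldExistence`, `SeifertRung`,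
  `origamiFoldExistence_of_seifert` (proved composition).
* bookkeeping shared by all three: `FoldData`, `FoldDataTransport`, `foldData_sphere_iff`.

Gen-2 revision (2026-08-16, planner-cruxidea-stmt-SmoothPoincare4-7844-3-g2-0): the transport
hypothesis `FoldDataTransport` is now DISCHARGED (`foldDataTransport_holds`) from the disprover's
landed `Theorems/OrigamiFoldExistence/Negative/ZeroSlack.lean` (`Negative.foldData_transport`,
p72874; Disproof.lean §2), so every composition below takes only the line's own two halves and the
route's support item `RoundSphereIsOrigamiFold` (stmt-7845). Where `M ≃ₕ S⁴` is consumed (the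
Disproof's `crux_false_without_homotopyEquiv` / `Negative.Disconnected`): only inside the
recognition halves (`MatchedSphereRecognition`, `StableSphereFoldRigidity`, `SeifertRung`) and the
existence halves, never in the bookkeeping.
-/

noncomputable section

-- the prescribed namespace `Summit.<P>.<Sub>.…` duplicates `SmoothPoincare4` (P = Sub)
set_option linter.dupNamespace false

open scoped Manifold ContDiff ContinuousMap Topology
open Literature.Geometry.Symplectic Literature.Geometry.Kaehler

namespace Summit.SmoothPoincare4.SmoothPoincare4.Cruxes.OrigamiFoldExistence.Ideator3

/-- Local notation for the model space `ℝ⁴`. -/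
local notation "E4" => EuclideanSpace ℝ (Fin 4)
/-- Local notation for the round 4-sphere. -/
local notation "𝕊⁴" => Metric.sphere (0 : EuclideanSpace ℝ (Fin 5)) 1
/-- Local notation for the round 3-sphere. -/
local notation "𝕊³" => Metric.sphere (0 : EuclideanSpace ℝ (Fin 4)) 1

open Summit.SmoothPoincare4.SmoothPoincare4.Theses.SymplecticOrigami

/-! ## Shared bookkeeping: fold data of one manifold, transport -/

/-- The fold data of `OrigamiFoldExistence` for ONE manifold `M` (verbatim the existential body
of the crux decl). -/
def FoldData (M : Type) [TopologicalSpace M] [T2Space M] [SecondCountableTopology M]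
    [ChartedSpace (EuclideanSpace ℝ (Fin 4)) M] [IsManifold (𝓡 4) ∞ M] : Prop :=
  ∃ (V : Fin 2 → TopologicalSpace.Opens M) (N : Fin 2 → Type) (_ : ∀ i, TopologicalSpace (N i)) (_ : ∀ i, T2Space (N i)) (_ : ∀ i, SecondCountableTopology (N i)) (_ : ∀ i, CompactSpace (N i)) (_ : ∀ i, ConnectedSpace (N i)) (_ : ∀ i, ChartedSpace (EuclideanSpace ℝ (Fin 4)) (N i)) (_ : ∀ i, IsManifold (𝓡 4) ∞ (N i)) (s : ∀ i, Literature.Geometry.Kaehler.MForm (𝓡 4) (N i) ℝ 2) (S : Fin 2 → Type) (_ : ∀ i, TopologicalSpace (S i)) (_ : ∀ i, CompactSpace (S i)) (_ : ∀ i, ConnectedSpace (S i)) (_ : ∀ i, ChartedSpace (EuclideanSpace ℝ (Fin 2)) (S i)) (_ : ∀ i, IsManifold (𝓡 2) ∞ (S i)) (b : ∀ i, S i → N i) (β : ∀ i, M → N i), (Disjoint (V 0) (V 1) ∧ (∀ i, (V i : Set M).Nonempty) ∧ IsConnected ((V 0 : Set M) ∪ (V 1 : Set M))ᶜ ∧ (∃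 (Z : Type) (_ : TopologicalSpace Z) (_ : ChartedSpace (EuclideanSpace ℝ (Fin 3)) Z) (_ : IsManifold (𝓡 3) ∞ Z) (z : Z → M), Manifold.IsSmoothEmbedding (𝓡 3) (𝓡 4) ∞ z ∧ Set.range z = ((V 0 : Set M) ∪ (V 1 : Set M))ᶜ)) ∧ (∀ i, Literature.Geometry.Kaehler.IsSmoothForm (s i) ∧ Literature.Geometry.Kaehler.IsClosedForm (s i) ∧ (∀ x (v : TangentSpace (𝓡 4) x), v ≠ 0 → ∃ w, s i x ![v, w] ≠ 0) ∧ Manifold.IsSmoothEmbedding (𝓡 2) (𝓡 4) ∞ (b i) ∧ (∀ y (v : TangentSpace (𝓡 2) y), v ≠ 0 → ∃ w : TangentSpace (𝓡 2) y, s i (b i y) ![mfderiv (𝓡 2) (𝓡 4) (b i) y v, mfderiv (𝓡 2) (𝓡 4) (b i) y w] ≠ 0) ∧ (∃ U : Set M, IsOpen U ∧ closure (V i : Set M) ⊆ U ∧ ContMDiffOn (𝓡 4) (𝓡 4) ∞ (β i) U) ∧ Set.InjOn (β i) (V i : Set M) ∧ β i '' (V i : Set M) = (Set.range (b i))ᶜ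 ∧ (∀ x ∈ (V i : Set M), Function.Bijective (mfderiv (𝓡 4) (𝓡 4) (β i) x)) ∧ β i '' frontier (V i : Set M) ⊆ Set.range (b i) ∧ (∀ x ∈ frontier (V i : Set M), Module.finrank ℝ (LinearMap.ker (mfderiv (𝓡 4) (𝓡 4) (β i) x).toLinearMap) = 1))

/-- The crux is literally "fold data on every homotopy 4-sphere". -/
theorem origamiFoldExistence_iff :
    OrigamiFoldExistence ↔
      ∀ (M : Type) [TopologicalSpace M] [T2Space M] [SecondCountableTopology M]
        [ChartedSpace (EuclideanSpace ℝ (Fin 4)) M] [IsManifold (𝓡 4) ∞ M],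
        M ≃ₕ 𝕊⁴ → FoldData M :=
  Iff.rfl

/-- The route's support item `RoundSphereIsOrigamiFold` is literally fold data on the round `S⁴`. -/
theorem foldData_sphere_iff : RoundSphereIsOrigamiFold ↔ FoldData 𝕊⁴ :=
  Iff.rfl

/-- Transport of fold data along a diffeomorphism (bookkeeping; a prover proves it by pushing all
the data through the diffeomorphism). -/
def FoldDataTransport : Prop :=
  ∀ (M : Type) [TopologicalSpace M] [T2Space M] [SecondCountableTopology M]
    [ChartedSpace (EuclideanSpace ℝ (Fin 4)) M] [IsManifold (𝓡 4) ∞ M],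
    Nonempty (M ≃ₘ⟮𝓡 4, 𝓡 4⟯ 𝕊⁴) → FoldData 𝕊⁴ → FoldData M

/-- `FoldDataTransport` HOLDS: it is the disprover's landed `Negative.foldData_transport`
(Theorems/OrigamiFoldExistence/Negative/ZeroSlack.lean, p72874) read through the definitional
unfolding of `FoldData`. -/
theorem foldDataTransport_holds : FoldDataTransport := by
  intro M _ _ _ _ _ hΦ hS
  obtain ⟨Φ⟩ := hΦ
  exact Summit.SmoothPoincare4.SmoothPoincare4.Theorems.OrigamiFoldExistence.Negative.foldData_transport
    Φ hS

/-- Generic closing step shared by the three lines: a recogniser `Σ ≅ S⁴` for every summit-shaped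
homotopy sphere, plus transport and the round example, give the crux. -/
theorem origamiFoldExistence_of_recogniser
    (hRec : ∀ (M : Type) [TopologicalSpace M] [T2Space M] [SecondCountableTopology M]
      [ChartedSpace (EuclideanSpace ℝ (Fin 4)) M] [IsManifold (𝓡 4) ∞ M],
      M ≃ₕ 𝕊⁴ → Nonempty (M ≃ₘ⟮𝓡 4, 𝓡 4⟯ 𝕊⁴))
    (hR : RoundSphereIsOrigamiFold) : OrigamiFoldExistence := by
  rw [origamiFoldExistence_iff]
  intro M _ _ _ _ _ e
  exact foldDataTransport_holds M (hRec M e) (foldData_sphere_iff.mp hR)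

-- (Zero slack, Disproof.lean §2: a recogniser for ALL homotopy spheres is `SmoothPoincare4` itself,
-- and then the crux follows by the landed `Negative.origamiFoldExistence_of_smoothPoincare4`.)

/-! ## Common vocabulary: symplectic forms -/

/-- A symplectic form on a 4-manifold: smooth, closed, pointwise nondegenerate (the route's own
clauses). -/
def IsSymplecticForm {X : Type*} [TopologicalSpace X] [ChartedSpace E4 X]
    (sf : MForm (𝓡 4) X ℝ 2) : Prop :=
  IsSmoothForm sf ∧ IsClosedForm sf ∧ ∀ x (v : TangentSpace (𝓡 4) x), v ≠ 0 → ∃ w, sf x ![v, w] ≠ 0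

/-! ## Card `euclidean-fold-germ` -/

section EuclideanFoldGerm

variable (M : Type) [TopologicalSpace M] [T2Space M] [SecondCountableTopology M]
  [ChartedSpace E4 M] [IsManifold (𝓡 4) ∞ M]

/-- **Inside-out exterior chart at `q`**: `ψ` maps the exterior region `{r₀ < ‖x‖}` of `ℝ⁴`
smoothly, injectively and with invertible differential into `M ∖ {q}`, and `ψ x → q` as
`‖x‖ → ∞` (so increasing radius moves TOWARDS the puncture; the image of a sphere `‖x‖ = r`
separates `q` from the rest of `M`, the "rest" lying on the side of smaller radii). -/
def IsInsideOutChart (q : M) (r₀ : ℝ) (ψ : E4 → punctured q) : Prop :=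
  0 < r₀ ∧ ContMDiffOn 𝓘(ℝ, E4) (𝓡 4) ∞ ψ {x | r₀ < ‖x‖} ∧ Set.InjOn ψ {x | r₀ < ‖x‖} ∧
    (∀ x : E4, r₀ < ‖x‖ → Function.Bijective (mfderiv 𝓘(ℝ, E4) (𝓡 4) ψ x)) ∧
    Filter.Tendsto (fun x => (ψ x : M)) (Filter.comap (fun x : E4 => ‖x‖) Filter.atTop) (𝓝 q)

/-- **Inside-out symplectic shell around the puncture.** Some symplectic form `ω` on `M ∖ {q}`
(arbitrary — in particular arbitrarily wild — between the shell and `q`) restricts, on the image of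
the round shell `r₁ < ‖x‖ < r₂` under an inside-out exterior chart, to the standard form `ω₀`.
By gluing `(ℝ⁴ ∖ B̄_{r₁}, ω₀)` onto the far side of the shell one obtains a symplectic manifold
diffeomorphic to `M ∖ pt` that is standard at infinity, so Gromov's recognition rel end applies
(`ShellRecognition`). -/
def HasInsideOutShell (q : M) : Prop :=
  ∃ (sf : MForm (𝓡 4) (punctured q) ℝ 2) (r₀ r₁ r₂ : ℝ) (ψ : E4 → punctured q),
    IsSymplecticForm sf ∧ IsInsideOutChart M q r₀ ψ ∧ r₀ ≤ r₁ ∧ r₁ < r₂ ∧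
    ∀ x : E4, r₁ < ‖x‖ → ‖x‖ < r₂ → ∀ v w : E4,
      sf (ψ x) ![mfderiv 𝓘(ℝ, E4) (𝓡 4) ψ x v, mfderiv 𝓘(ℝ, E4) (𝓡 4) ψ x w] =
        stdSymplecticForm v w

/-- **Matched sphere (transfer C⁺ of the card).** Some symplectic form `ω` on `M ∖ {q}` agrees
POINTWISE ALONG ONE SPHERE `ψ(r·S³)` around the puncture — on full tangent spaces, via the linear
identifications `Dψ_{r x} ∘ (DG_x)⁻¹` — with the standard form `ω₀` along the boundary `G(S³)` of an
embedded Euclidean ball `G(B̄⁴) ⊂ ℝ⁴`. Tangentially this says: the Hamiltonian structure the fold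
would induce on the sphere is realised, with the correct co-orientation (fake side ↔ inside of
`G(B̄⁴)`), by an embedded hypersurface of `(ℝ⁴, ω₀)`; the normal components fix the sides. By the
relative Moser/Weinstein theorem two symplectic forms agreeing on `TM|_S` are intertwined near `S`
by a germ of diffeomorphism with identity 1-jet along `S`, so a matched sphere upgrades to a thin
(non-round) inside-out shell and the same gluing applies (`MatchedSphereRecognition`). -/
def HasMatchedSphere (q : M) : Prop :=
  ∃ (sf : MForm (𝓡 4) (punctured q) ℝ 2) (r₀ r : ℝ) (ψ : E4 → punctured q) (G : E4 → E4),
    IsSymplecticForm sf ∧ IsInsideOutChart M q r₀ ψ ∧ r₀ < r ∧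
    ContDiff ℝ ∞ G ∧ Set.InjOn G (Metric.closedBall 0 1) ∧
    (∀ x ∈ Metric.closedBall (0 : E4) 1, Function.Bijective (fderiv ℝ G x)) ∧
    ∀ x : E4, ‖x‖ = 1 → ∀ v w : E4,
      sf (ψ (r • x)) ![mfderiv 𝓘(ℝ, E4) (𝓡 4) ψ (r • x) v, mfderiv 𝓘(ℝ, E4) (𝓡 4) ψ (r • x) w] =
        stdSymplecticForm (fderiv ℝ G x v) (fderiv ℝ G x w)

end EuclideanFoldGerm

/-- A shell is a matched sphere (take `G = r' • id` for any `r₁ < r' < r₂`): recorded as a statement;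
its proof is the homogeneity `ω₀(r'v, r'w) = r'² ω₀(v, w)` against the chain rule for
`x ↦ ψ(r' x)` — left to the line. -/
def ShellIsMatched : Prop :=
  ∀ (M : Type) [TopologicalSpace M] [T2Space M] [SecondCountableTopology M]
    [ChartedSpace E4 M] [IsManifold (𝓡 4) ∞ M] (q : M), HasInsideOutShell M q → HasMatchedSphere M q

/-- **Shell recognition** (= Gromov–McDuff recognition of `ℝ⁴` rel end, route SymplecticCap's crux
`GromovRecognitionRelEnd` / the named fact `gromov_recognitionR4_relEnd`, after the gluing described
at `HasInsideOutShell`): a homotopy 4-sphere with an inside-out symplectic shell is `S⁴`. -/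
def ShellRecognition : Prop :=
  ∀ (M : Type) [TopologicalSpace M] [T2Space M] [SecondCountableTopology M]
    [ChartedSpace E4 M] [IsManifold (𝓡 4) ∞ M], M ≃ₕ 𝕊⁴ →
    ∀ q : M, HasInsideOutShell M q → Nonempty (M ≃ₘ⟮𝓡 4, 𝓡 4⟯ 𝕊⁴)

/-- **Matched-sphere recognition (FIRST LEMMA of the card, the holography statement)**: a homotopy
4-sphere carrying, for some symplectic form on a punctured copy, ONE sphere around the puncture whose
induced (co-oriented) Hamiltonian structure is Euclidean, is `S⁴`. Proof plan: relative Moser ⇒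
thin shell ⇒ glue `ℝ⁴ ∖ G(B⁴)` ⇒ symplectic fake `ℝ⁴` standard at infinity ⇒
`gromov_recognitionR4_relEnd` ⇒ `M ∖ pt ≅ ℝ⁴` ⇒ `M ≅ S⁴`. -/
def MatchedSphereRecognition : Prop :=
  ∀ (M : Type) [TopologicalSpace M] [T2Space M] [SecondCountableTopology M]
    [ChartedSpace E4 M] [IsManifold (𝓡 4) ∞ M], M ≃ₕ 𝕊⁴ →
    ∀ q : M, HasMatchedSphere M q → Nonempty (M ≃ₘ⟮𝓡 4, 𝓡 4⟯ 𝕊⁴)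

/-- **Matched-sphere existence** (the crux of the line; zero slack like E itself, but with the
maximal target set: ANY Euclidean-realisable sphere dynamics, contact-type or not). -/
def MatchedSphereExistence : Prop :=
  ∀ (M : Type) [TopologicalSpace M] [T2Space M] [SecondCountableTopology M]
    [ChartedSpace E4 M] [IsManifold (𝓡 4) ∞ M], M ≃ₕ 𝕊⁴ → ∃ q : M, HasMatchedSphere M q

/-- Composition concluding the crux BY NAME from the card's two halves plus bookkeeping. -/
theorem origamiFoldExistence_of_matchedSphere (hR : MatchedSphereRecognition)
    (hE : MatchedSphereExistence) (hS : RoundSphereIsOrigamiFold) :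
    OrigamiFoldExistence := by
  refine origamiFoldExistence_of_recogniser ?_ hS
  intro M _ _ _ _ _ e
  obtain ⟨q, hq⟩ := hE M e
  exact hR M e q hq

/-! ## Card `stable-fold-ladder` -/

section StableFold

variable {M : Type} [TopologicalSpace M] [T2Space M] [SecondCountableTopology M]
  [ChartedSpace E4 M] [IsManifold (𝓡 4) ∞ M]
variable {N : Type} [TopologicalSpace N] [ChartedSpace (EuclideanSpace ℝ (Fin 3)) N]

/-- **Stable fold** (Cieliebak–Volkov, vector-field form of a stabilising 1-form; von Bergmann 2007
Def. 1.4): `s` is folded along `j : N ↪ M` (`IsFoldedForm`), `R` is a nowhere-zero section of the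
null line field of `σ := j*s` on `N`, and `α` is a smooth 1-form on `N` with `α(R) = 1`,
`ι_R dα = 0`, and `σ` nondegenerate on `ker α` (i.e. `α ∧ σ > 0`). -/
def IsStableFold (s : MForm (𝓡 4) M ℝ 2) (j : N → M)
    (R : (n : N) → TangentSpace (𝓡 3) n) (α : MForm (𝓡 3) N ℝ 1) : Prop :=
  IsFoldedForm s N j ∧ IsSmoothForm α ∧
    (∀ n, R n ≠ 0) ∧
    (∀ n (w : TangentSpace (𝓡 3) n),
      s (j n) ![mfderiv (𝓡 3) (𝓡 4) j n (R n), mfderiv (𝓡 3) (𝓡 4) j n w] = 0) ∧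
    (∀ n, α n ![R n] = 1) ∧
    (∀ n (w : TangentSpace (𝓡 3) n), mextDeriv α n ![R n, w] = 0) ∧
    (∀ n (v : TangentSpace (𝓡 3) n), α n ![v] = 0 → v ≠ 0 →
      ∃ w : TangentSpace (𝓡 3) n, α n ![w] = 0 ∧
        s (j n) ![mfderiv (𝓡 3) (𝓡 4) j n v, mfderiv (𝓡 3) (𝓡 4) j n w] ≠ 0)

end StableFold

/-- **(P) Stable sphere-fold existence**: every homotopy 4-sphere carries a folded symplectic form
whose fold is an embedded 3-sphere along which the induced Hamiltonian structure is stabilisable.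
(Cannas da Silva 2010 gives the folded form with prescribed fold but no control of the fold germ;
the SHS rung is the first at which a Fredholm theory of folded holomorphic curves exists.) -/
def StableSphereFoldExistence : Prop :=
  ∀ (M : Type) [TopologicalSpace M] [T2Space M] [SecondCountableTopology M]
    [ChartedSpace E4 M] [IsManifold (𝓡 4) ∞ M], M ≃ₕ 𝕊⁴ →
    ∃ (s : MForm (𝓡 4) M ℝ 2) (j : 𝕊³ → M) (R : (n : 𝕊³) → TangentSpace (𝓡 3) n)
      (α : MForm (𝓡 3) (𝕊³) ℝ 1), IsStableFold s j R α

/-- **(R) Stable sphere-fold rigidity** (mixed-type stable filling rigidity, the new recognition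
problem of the line): a homotopy 4-sphere folded along an embedded 3-sphere with STABLE fold is
`S⁴` — equivalently: two exact symplectic homotopy 4-balls glued fold-wise along a common stable
Hamiltonian structure on `S³` give `S⁴`. Known sub-case: contact-type fold (then both sides are
convex fillings of a tight `S³`, hence balls: Eliashberg 1990 / Gromov–McDuff). -/
def StableSphereFoldRigidity : Prop :=
  ∀ (M : Type) [TopologicalSpace M] [T2Space M] [SecondCountableTopology M]
    [ChartedSpace E4 M] [IsManifold (𝓡 4) ∞ M], M ≃ₕ 𝕊⁴ →
    (∃ (s : MForm (𝓡 4) M ℝ 2) (j : 𝕊³ → M) (R : (n : 𝕊³) → TangentSpace (𝓡 3) n)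
      (α : MForm (𝓡 3) (𝕊³) ℝ 1), IsStableFold s j R α) →
    Nonempty (M ≃ₘ⟮𝓡 4, 𝓡 4⟯ 𝕊⁴)

/-- Composition concluding the crux BY NAME. -/
theorem origamiFoldExistence_of_stableFold (hP : StableSphereFoldExistence)
    (hR : StableSphereFoldRigidity) (hS : RoundSphereIsOrigamiFold) :
    OrigamiFoldExistence :=
  origamiFoldExistence_of_recogniser (fun M _ _ _ _ _ e => hR M e (hP M e)) hS

/-! ## Card `orbifold-unfolding-cork-seams` -/

section Seifert

variable {M : Type} [TopologicalSpace M] [ChartedSpace E4 M]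

/-- **Seifert (orbi-)origami form**: `IsOrigamiForm` with the FREENESS of the null circle action
relaxed to "effective with finite stabilisers" (a locally free action; every null leaf is a closed
orbit; by Epstein 1972 any fold all of whose null leaves are compact is of this kind). Unfolding
then produces symplectic 4-ORBIFOLDS with cyclic quotient singularities along the collapsed fold
(orbifold version of CdGP Prop. 2.8, informal). -/
structure IsSeifertOrigamiForm (s : MForm (𝓡 4) M ℝ 2) : Prop where
  /-- The fold data and the Seifert null fibration exist. -/
  exists_fold : ∃ (N : Type) (_ : TopologicalSpace N) (_ : ChartedSpace (EuclideanSpace ℝ (Fin 3)) N)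
      (_ : IsManifold (𝓡 3) ∞ N) (_ : CompactSpace N) (_ : ConnectedSpace N)
      (j : N → M) (θ : Circle → N → N),
    IsFoldedForm s N j ∧
    ContMDiff ((𝓡 1).prod (𝓡 3)) (𝓡 3) ∞ (fun p : Circle × N => θ p.1 p.2) ∧
    (∀ n, θ 1 n = n) ∧ (∀ a b n, θ (a * b) n = θ a (θ b n)) ∧
    (∀ a, (∀ n, θ a n = n) → a = 1) ∧
    (∀ n, Set.Finite {a : Circle | θ a n = n}) ∧
    (∀ (n : N) (w : TangentSpace (𝓡 4) (j n)),
      s (j n) ![mfderiv 𝓘(ℝ, ℝ) (𝓡 4) (fun t : ℝ => j (θ (Circle.exp t) n)) 0 (1 : ℝ), w] = 0)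

end Seifert

/-- **(E_orb) Seifert fold existence**: every homotopy 4-sphere carries a Seifert origami form with
connected fold (intended source: a cork decomposition `Σ = (S⁴ ∖ C) ∪_τ C` whose seam `∂C` is a
small Seifert homology sphere — Boileau–Otal: `τ` is then isotopic to a fibre-preserving map — with
both sides Stein fillings of the transverse contact structure, capped by the positive orbi-disc
bundle). -/
def SeifertFoldExistence : Prop :=
  ∀ (M : Type) [TopologicalSpace M] [T2Space M] [SecondCountableTopology M]
    [ChartedSpace E4 M] [IsManifold (𝓡 4) ∞ M], M ≃ₕ 𝕊⁴ →
    ∃ s : MForm (𝓡 4) M ℝ 2, IsSeifertOrigamiForm s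

/-- **(R_orb) Seifert rung**: a homotopy 4-sphere with a Seifert origami form with connected fold is
`S⁴` (orbifold version of `OrigamiRung ∧ NoGenusTwoDoor`: the pinch makes the two symplectic
orbifold pieces `b₂ = b⁺ = 1` with a positive symplectic orbi-sphere; W. Chen's orbifold
Taubes/McDuff theory makes them rational; rank-one log del Pezzo pairs with contractible smooth
complement are then classified). -/
def SeifertRung : Prop :=
  ∀ (M : Type) [TopologicalSpace M] [T2Space M] [SecondCountableTopology M]
    [ChartedSpace E4 M] [IsManifold (𝓡 4) ∞ M], M ≃ₕ 𝕊⁴ →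
    (∃ s : MForm (𝓡 4) M ℝ 2, IsSeifertOrigamiForm s) → Nonempty (M ≃ₘ⟮𝓡 4, 𝓡 4⟯ 𝕊⁴)

/-- Composition concluding the crux BY NAME. -/
theorem origamiFoldExistence_of_seifert (hE : SeifertFoldExistence) (hR : SeifertRung)
    (hS : RoundSphereIsOrigamiFold) : OrigamiFoldExistence :=
  origamiFoldExistence_of_recogniser (fun M _ _ _ _ _ e => hR M e (hE M e)) hS

/-- A (free) origami form is a Seifert origami form when its fold is connected — sanity link to the
tree's `IsOrigamiForm` (statement only; the proof unpacks the existential and uses that a free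
action has trivial, hence finite, stabilisers). -/
def OrigamiIsSeifert : Prop :=
  ∀ (M : Type) [TopologicalSpace M] [ChartedSpace E4 M] (s : MForm (𝓡 4) M ℝ 2),
    IsOrigamiForm s → IsConnected (fold s) → IsSeifertOrigamiForm s

end Summit.SmoothPoincare4.SmoothPoincare4.Cruxes.OrigamiFoldExistence.Ideator3

end
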